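import Literature.MathematicalPhysics.QuantumFieldTheory.Balaban1983to89.T4ContinuumYM4Torus
import Literature.MathematicalPhysics.QuantumFieldTheory.Balaban1983to89.Node00.DatumAvLayer
import Literature.MathematicalPhysics.QuantumFieldTheory.Balaban1983to89.B10CompactBinding
import Summits.QuantumFields.BalabanUV.T4Continuum.Spine.NE7.Targets

/-!
# BalabanUVNodes ∕ Clusters (1∕3) — the UV rung R4 `UVD59 N` SPLIT BY CLUSTER in the chair's cut R420 (C): carriers, the three record-predicate
# PARAMETERS, the 23 stub signatures `S_<node>`, the cluster statements K1 «KnitIR» · K2 «FlowBounds» · K3 «RenormalisationBeta» · K5 «SpineMatching»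
# (+ K4's conclusion hook `SpineRates Rec Inputs`), and EVERY join kernel-checked for an ARBITRARY record predicate

MAINTENANCE NOTE (leaf split, R201, 2026-08-27): the `Iff.rfl` tether `uvD59_two_iff : UVD59 2 ↔ …Theses.BalabanLadder.UV` and the §6 ladder glue (`ladderUV_of_clusters(₄)`, `apex_of_ladderUV`, `uvApex_of_ladderUV`) now live VERBATIM (same names, namespace `YMDAG.UVSplit`) in the leaf module `Summits.QuantumFields.YangMills.Theorems.BalabanUVNodesClustersLeaf`, the only module of this chain importing `Theses.BalabanLadder`; this module no longer imports the spine route file, so route edits do not rebuild the Track-A node cone. Every other byte below is unchanged; references to the tether in the text below are to that leaf.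

FILE LAYOUT (courier split at the §4∕§5 boundary, 2026-08-26, for the gate's lint «Theorems files with proofs are ≤ 400 lines»; every declaration,
statement, proof, docstring and name UNCHANGED from v3 98f4c88edf268b6b): THIS module = §§1–4 (carriers, the three parameters, the rung `UVD59` WITH its
`Iff.rfl` tether `uvD59_two_iff` and apex readings, the 23 stub signatures incl. the N08 glue `S_N08_of_upC`, the cluster statements); the §5 JOINS and the
§6 ladder glue (15 theorems) are `BalabanUVNodesClusters.lean`, which imports this file and KEEPS the module name every consumer imports
(`import Summits.QuantumFields.YangMills.Theorems.BalabanUVNodesClusters` unchanged; same namespace `YMDAG.UVSplit`).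

SUPPLY TEXT (b2b-balaban-t4-dagwriter gen 76, v2 gen 80, v3 gen 82, 2026-08-25∕26) for the ONE WRITER of route «BalabanUVNodes» (pub-ymgap plan, director-ym
LINE №8a, D-0061) to file through a prover ∕ dag seat — `Summits/…/Theorems` is prover-only (D-0016); the dagwriter seat opens, edits and files NOTHING.
V2 = THE ANSWER TO REVIEW p409153 (revise, 2026-08-25T22:08Z), point by point.  (1) TETHER: `UVD59 2` is now tied IN THE KERNEL to the tree's leaf of
record `Summit.QuantumFields.YangMills.Theses.BalabanLadder.UV` (spine route `route-QuantumFields-BalabanLadder`, item stmt-QuantumFields-19351,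
`Theses/BalabanLadder.lean`, imported) by `uvD59_two_iff : UVD59 2 ↔ …BalabanLadder.UV := Iff.rfl`, and §6 carries every top join to that leaf BY NAME
(`ladderUV_of_clusters`, `ladderUV_of_clusters₄`, `apex_of_ladderUV`, `uvApex_of_ladderUV`); no non-tree name is cited anywhere.  (2) N08 ∕ [B10]: the
stub text `S_N08 Rec := AtRecord Rec Dag.B10_main` is the node's statement of record UNEDITED (plan g60 [YMPLAN-G60-V1216-ONE-RECORD-NO-RESTATE], chair
R434 (Q2) = (C) COMPACT) — NOT dead text: whether it is satisfiable is a property of the record predicate's BINDING clause, which this module does not fix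
(`Rec` is a parameter).  Under the (C) binding `B10CompactBinding.ofPrintedAllXPNC` over carriers whose B10 runs are leaf-system tower runs, N08 HOLDS at
every run, in-edges unused — kernel: `S_N08_of_upC` below (`B10CompactBinding.b10_main_of_upC`; record form `B10NodeKnit.b10_main_at_record_of_leafSystemPin`);
the vacuity dichotomy `B10NodeKnit.b10_main_iff_inEdge_fails_of_fineLattices` is hypothesised on the LITERAL N-binding `w.up P = Upstream.ofPrintedAllXPN
(X.withTowerRuns10 T) …` on fine-lattice families and does not bear on a (C)-bound record.  NODE 00's predicate of record binds (C) from its B10-pin stage on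
(chair R434); its Stage ₅ as landed (`Node00.IsRecordOfRecord₅`, `Node00/Record5.lean`, p410529 ✓ eac0f0ad8e10) still carries the Stage-3 N-binding
(`Node00.upOfRecord₅ θ P = Upstream.ofPrintedAllXPN (carriers₃ …) …`) with the B10 carriers RESIDUAL — the cluster
items are instantiated over the TERMINAL stage only (director-ym №17, plan g60 (L2)), never over ₅.  No `(B10 : Dag.Leaves → Prop)` parameter: a
Leaves-level parameter would change the node's shape, not the reading of `b10` (R434).  (3) `namespace YMDAG.UVSplit` is DELIBERATE: modules 2–6 of this
chain, the BC3 skeleton templates and the staged consumers of dag-n19∕n20∕n21∕n23∕n27 address `YMDAG.UVSplit.*` by name (tree precedent: the venue's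
`YMDAG.*` modules, e.g. `YMDAG.N14`); renaming now would break five seats' staged bytes for no content.  The former aside `N28_B6lit` (no consumer) is
DROPPED — N28's literal side conditions live in the tree as `BalabanUVNodesN28SideConditions.lean`; `N26_B4lit` stays (consumer:
`BalabanUVNodesN26BetaCont.lean`).  V3 (gen 82) = V2 with ONE located change for the typer lint (chair R440 proviso (c) «no `instance`»; precedent
`Node00/Record8.lean` p414247): the global `attribute [instance] SpineCarriers.dec` of v1∕v2 is GONE — the structure-carried `DecidableEq S.ι` is brought
into scope TERM-LOCALLY by `letI := S.dec` at the one statement whose target needs it (`S_N19`: `NE7.Core` carries `[DecidableEq ι]`; `RelWeightBound` ∕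
`ShellWeightBound` carry none), and `SpineMatching_of` hands `S.dec` to `SpineDatum`'s explicit `DecidableEq` witness as before; every other declaration
is byte-identical to v2 752f2cb5b04927e7.  A consumer writing `NE7.Core … S.T S.Bad …` ∕ `S.T K \ S.Bad K t` over a bundle `S` writes `letI := S.dec; …`.
WHY A `YangMills/Theorems` HOME: a route file may import only Mathlib ∕ Literature ∕ HarnessLib ∕ `Summits.<P>.Statement` ∕ `Summits.<P>.Theorems.*`
(gate, verbatim, 2026-08-25) — NOT the `Summits.QuantumFields.BalabanUV.*` subtree these statements are typed over; a Theorems module may import it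
(precedent `Y2BridgeKing.lean` ⟵ `Summits.Ventures.…`), and the route then lists `imports: [Summits.QuantumFields.YangMills.Theorems.<this module>]`.
HONEST FRAMING.  Typing and bookkeeping only: hypothesis shapes named in `def`s, joins = compositions of tree theorems; 0 `sorry`, 0 `opaque`, standard
axioms.  NOTHING of Bałaban's is asserted, no node is discharged; [B12] Thm 2 unproved in print; NE7 ∕ NE7b ∕ NE7c not proved; ONE finite four-torus
programme — NOT infinite volume, NOT OS on ℝ⁴, NOT a mass gap, NOT Clay; `UVD59` is NOT the Y2 bridge's `UV G r a := MomentBounds6 G r a`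
(`Y2BridgeKing.lean`): no tree arrow joins the two currencies (the spine route owner's seam item, LINE №5).

THE RUNG OF RECORD.  `UVD59 N` := the spine route's rung-R4 leaf `Summit.QuantumFields.YangMills.Theses.BalabanLadder.UV` at `SU(N)` (`UVD59 2` IS that
leaf, `uvD59_two_iff`, `Iff.rfl`): for every four-torus family a Stage-0 datum of record (`Node00.IsDatumOfRecord₀`) AT WHICH (B) = B2, END = B3 and the
spine package B5 hold; `UVApex N` = the apex reading.
THE ONE DESIGN DECISION — THE RECORD PREDICATE IS A PARAMETER, EXISTENCE IS A STUB: every record-dependent statement is written over ONE predicate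
`Rec : RecordPred N` («(D, w) are Bałaban's datum of record over F and its binding world of record» = NODE 00's notion, DEFINITION FIRST, R422 (A)), on the
spine ONE per-string carrier predicate `SRec : SpineRecordPred N` and ONE inputs predicate `Inputs : InputsPred N` (= cluster K4's conclusion; module 2∕3
instantiates it as `RateInputs RRec`).  All joins (`KnitIR_of`, `FlowBounds_of`, `RenormalisationBeta_of`, `SpineMatching_of`, `B2_at_record` (= N24),
`B5_at_record` (= N27), `uvD59_of_clusters`, `uvD59_of_clusters₄`) hold FOR EVERY `Rec`, `SRec`, `Inputs`: when NODE 00 lands the DEFINITION of its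
predicate, instantiation is a substitution and existence stays the separate stub `S_W00`.  Module 3∕3 (`…Stages`) is the kernel evidence that a STAGE frame
(Stages 0∕2∕3 of NODE 00) is inhabited yet NOT a record predicate the cluster items may be closed over.
THE CUT = R420 (C), node ↦ decl 1:1: K1 rank 2 `S_N01 S_N02 S_N23 S_W00` · K2 rank 3 `S_N03 S_N06 S_N10 S_N09 S_N11 S_N13` · K3 rank 4 `S_N04 S_N05 S_N07
S_N08 S_N12 S_N25 S_BetaSide` (glue N26∕N28 vacated: `N26_B4lit` aside; N28 = tree `BalabanUVNodesN28SideConditions`) · K4 rank 5 = module 2∕3 · K5 rank 6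
`S_N27x S_N20 S_N21 S_N19 S_U4`
· K6 «NodeOAcrossSmall» rank 7 not typed (no node-level consumer of `NodeOLetters.acrossSmall_of_letters` in the tree; `aside` until plan types the edge).
`closes` shape: `uvD59_of_clusters : KnitIR → FlowBounds → RenormalisationBeta → SpineRates → SpineMatching → UVD59 N`; form-agnostic twin
`uvD59_of_clusters₄ : KnitIR → FlowBounds → RenormalisationBeta → Spine → UVD59 N` (K4+K5 merged as `Spine` = B5 at the record); at `N = 2` both
land on the leaf `…BalabanLadder.UV` by name (§6).
Text of record: dagwriter g74 `UVSplit.lean` f92296f88db56e01 §§1–5 verbatim (words: `UV-SPLIT-dagwriter-g74.md` 3e1579fc5e572c22).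
-/

namespace YMDAG.UVSplit

open Literature.MathematicalPhysics.QuantumFieldTheory.Balaban1983to89
open Literature.MathematicalPhysics.QuantumFieldTheory.Balaban1983to89.T4Continuum
open Summit.QuantumFields.BalabanUV.T4Continuum.Spine

/-! ## §1 Carriers and the three PARAMETERS -/

/-- `SU(N)`. -/
abbrev SU (N : ℕ) : Type := Matrix.specialUnitaryGroup (Fin N) ℂ

/-- Finite-`ε` data on `SU(N)` over the four-torus family `F` (the venue's `YMDAG.Datum`; R420 (B): the tree's own generality, `[NeZero N]`). -/
abbrev Datum (F : T4Family) (N : ℕ) [NeZero N] := FiniteEpsData F (SU N)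

/-- PARAMETER 1 — the type of NODE 00's notion «(D, w) are Bałaban's datum of record over `F` and its binding world of record». -/
abbrev RecordPred (N : ℕ) [NeZero N] := ∀ F : T4Family, Datum F N → DagBinding.WorldP → Prop

/-- The term-class carriers of ONE loop string along ONE tuned run (what `T4MatchingAssembly.StringHybridNE7` quantifies): index type of term classes,
radius `l₀`, volume letter `vol`, offset `K₀`, classes `T`, the two runs' term weights `A`, `B`, indicator shells `shA`, `shB`, bad classes `Bad`, weights
`W`, `Wsh`, remainder `δ` — shared by N19, N20, N21, U4′, E1∕E2, hence ONE bundle. -/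
structure SpineCarriers where
  ι : Type
  [dec : DecidableEq ι]
  l₀ : ℝ
  vol : ℝ
  K₀ : ℕ
  T : ℕ → Finset ι
  A : ℕ → ℝ → ι → ℝ
  B : ℕ → ℝ → ι → ℝ
  shA : ℕ → ℝ → ι → ℝ
  shB : ℕ → ℝ → ι → ℝ
  Bad : ℕ → ℝ → Finset ι
  W : ℕ → ℝ
  Wsh : ℕ → ℝ
  δ : ℕ → ℝ

-- Bundled-carrier idiom WITHOUT an instance attribute (v3, typer lint): the structure-carried `DecidableEq S.ι` is used term-locally as
-- `letI := S.dec; …` where a target needs it (`S_N19` below); NO `instance`, NO `attribute [instance]`, nothing registered globally.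

/-- PARAMETER 2 — «`S` are the term-class carriers OF RECORD of Bałaban's two runs (`K₀ + K`, `K₀ + K + 1` steps) for the datum `D`, the tuned bare
sequence `g₀`, the loop string `os`» (venue `CarriersOfRecordN19∕N20∕N21` as ONE coherent predicate). -/
abbrev SpineRecordPred (N : ℕ) [NeZero N] := ∀ F : T4Family, Datum F N → (ℕ → ℝ) → List (ULoop F) → SpineCarriers → Prop

/-- PARAMETER 3 — cluster K4's conclusion «the in-edges of N19 (NE1′, NE2, NE3, NE4, NE5, NE9 at their carriers of record) hold for (D, g₀, os)»;
instantiated by the conjunction of the venue's by-name statements N14–N18, N22.  `fun _ _ _ _ => True` recovers R420's unguarded K5. -/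
abbrev InputsPred (N : ℕ) [NeZero N] := ∀ F : T4Family, Datum F N → (ℕ → ℝ) → List (ULoop F) → Prop

/-! ## §2 The rung CLOSED — the leaf of record `…BalabanLadder.UV`, at the tree's generality `SU(N)` -/

/-- **`UVD59 N`** = the rung-R4 leaf of record at `SU(N)` (guard `2 ≤ N` is the caller's): on every four-torus family some Stage-0 datum of record
carries (B) = B2, END = B3 and the spine package B5.  `UVD59 2` IS `Summit.QuantumFields.YangMills.Theses.BalabanLadder.UV` (`uvD59_two_iff`, `Iff.rfl`).
OPEN; never asserted. -/
def UVD59 (N : ℕ) [NeZero N] : Prop :=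
  ∀ F : T4Family, ∃ D : Datum F N,
    Node00.IsDatumOfRecord₀ F N D ∧ B16.EndStatementBPrinted D.C ∧ DagBinding.EndpointExistence D.C.toB12 ∧
      T4ApexHybrid.HybridNE7Under D (DagBinding.EndpointExistence D.C.toB12)

/-- THE APEX READING (kernel, at every `N`; at `N = 2` = `apex_of_ladderUV` §6): on every family, a datum of record WITH the hypothesis-free conclusion of the
T⁴ apex in both tuned-sequence readings (`continuumYM4_torus_of_endpointExistence_nonvacuous` :821; B1 by `Node00.isPrintedAveraged_of_isDatumOfRecord₀`). -/
theorem apex_of_uvD59 {N : ℕ} [NeZero N] (h : UVD59 N) (F : T4Family) :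
    ∃ D : Datum F N, Node00.IsDatumOfRecord₀ F N D ∧ DagBinding.EndpointExistence D.C.toB12 ∧
      T4ContinuumYM4Torus.ContinuumYM4Torus D ∧ T4ContinuumYM4Torus.ContinuumYM4TorusE D := by
  obtain ⟨D, hrec, hB, hEnd, hNE⟩ := h F
  exact ⟨D, hrec, hEnd, T4ContinuumYM4Torus.continuumYM4_torus_of_endpointExistence_nonvacuous D
    (Node00.isPrintedAveraged_of_isDatumOfRecord₀ F N D hrec) hB hEnd hNE⟩

/-- The closed ∃-form in apex currency: some printed-averaged datum has the continuum limit in both readings.  OPEN; never asserted. -/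
def UVApex (N : ℕ) [NeZero N] : Prop :=
  ∃ (F : T4Family) (D : Datum F N), D.IsPrintedAveraged ∧
    T4ContinuumYM4Torus.ContinuumYM4Torus D ∧ T4ContinuumYM4Torus.ContinuumYM4TorusE D

/-- `UVD59 ⟹ UVApex` on any family (kernel). -/
theorem uvApex_of_uvD59 {N : ℕ} [NeZero N] (h : UVD59 N) (F : T4Family) : UVApex N := by
  obtain ⟨D, hrec, -, hT⟩ := apex_of_uvD59 h F
  exact ⟨F, D, Node00.isPrintedAveraged_of_isDatumOfRecord₀ F N D hrec, hT⟩

section Split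

variable {N : ℕ} [NeZero N] (Rec : RecordPred N) (SRec : SpineRecordPred N) (Inputs : InputsPred N)

/-- «statement `X` of the leaf assignment holds at every run of every world of record» — the shape of every paper-node stub. -/
abbrev AtRecord (X : Dag.Leaves → Prop) : Prop :=
  ∀ (F : T4Family) (D : Datum F N) (w : DagBinding.WorldP), Rec F D w → ∀ P : B12.RunParams, X (DagBinding.leavesP w P)

/-! ## §3 The 23 stub SIGNATURES as named `Prop`s (a skeleton quotes them: `theorem stub_N01 : S_N01 <Rec> := by sorry`) -/

/-! ### K1 «KnitIR» (rank 2): N01 · N02 · N23 · W00 -/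

/-- W00 · NODE 00's object slot: for every family the datum of record and its binding world EXIST (construction), and the world is bound to the
datum's construction with positive interval constant and the RG equations (0.20) along every run ([Balaban1987RG1] (0.20) p. 257). -/
def S_W00 : Prop :=
  (∀ F : T4Family, ∃ (D : Datum F N) (w : DagBinding.WorldP), Rec F D w) ∧
    ∀ (F : T4Family) (D : Datum F N) (w : DagBinding.WorldP), Rec F D w →
      w.C = D.C ∧ 0 < w.γ ∧ ∀ P : B12.RunParams, (DagBinding.leavesP w P).rgFlow

/-- N01 · [B4, Balaban1983RegularityDecay] `Dag.B4_main` at the record (theorem TODAY over Stage 1∕2: `Node00.b4_main_of_isWorldOfRecord₁∕₂`). -/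
def S_N01 : Prop := AtRecord Rec Dag.B4_main
/-- N02 · [B5, Balaban1984PropagatorsI] `Dag.B5_main` («b4 → b5»; theorem TODAY: `Node00.b5_main_of_isWorldOfRecord₁∕₂`). -/
def S_N02 : Prop := AtRecord Rec Dag.B5_main
/-- N23 · binder B1 through the Stage-0 datum clause the rung text carries: the datum of record has Bałaban's averaging of record
(`Node00.IsDatumOfRecord₀`; B1 = `IsPrintedAveraged` then by `Node00.isPrintedAveraged_of_isDatumOfRecord₀`). -/
def S_N23 : Prop := ∀ (F : T4Family) (D : Datum F N) (w : DagBinding.WorldP), Rec F D w → Node00.IsDatumOfRecord₀ F N D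

/-! ### K2 «FlowBounds» (rank 3): N03 · N06 · N10 · N09 · N11 · N13 -/

/-- N03 · [B6, Balaban1984PropagatorsII] `Dag.B6_main` (one-level case TODAY: `Node00.b6_main_of_isWorldOfRecord₁OL`; k-level carriers p404155). -/
def S_N03 : Prop := AtRecord Rec Dag.B6_main
/-- N06 · [B9] `Dag.B9_main`. -/
def S_N06 : Prop := AtRecord Rec Dag.B9_main
/-- N10 · [B13] `Dag.B13_main` (small-field step; NODE O's across-small input enters its PROOF, R420 K6). -/
def S_N10 : Prop := AtRecord Rec Dag.B13_main
/-- N09 · [B12, Balaban1987RG1] `Dag.B12_main`. -/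
def S_N09 : Prop := AtRecord Rec Dag.B12_main
/-- N11 · [B14, Balaban1988Convergent] `Dag.B14_main`. -/
def S_N11 : Prop := AtRecord Rec Dag.B14_main
/-- N13 · [B16, Balaban1989LargeFieldII] `Dag.B16_main`. -/
def S_N13 : Prop := AtRecord Rec Dag.B16_main

/-! ### K3 «RenormalisationBeta» (rank 4): N04 · N05 · N07 · N08 · N12 · N25 · BetaSide (glue N26∕N28 vacated; N28's side conditions = tree
`BalabanUVNodesN28SideConditions.lean`) -/

/-- N04 · [B7, Balaban1985Averaging] `Dag.B7_main` (theorem TODAY over Stage 2: `Node00.b7_main_of_isWorldOfRecord₂`). -/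
def S_N04 : Prop := AtRecord Rec Dag.B7_main
/-- N05 · [B8] `Dag.B8_main`. -/
def S_N05 : Prop := AtRecord Rec Dag.B8_main
/-- N07 · [B11, Balaban1985Variational] `Dag.B11_main`. -/
def S_N07 : Prop := AtRecord Rec Dag.B11_main
/-- N08 · [B10, Balaban1985UV3 Thm 1 p. 257 + Thm 2 p. 272] `Dag.B10_main` (`ℓ.b5 → ℓ.b6 → ℓ.b7 → ℓ.b8 → ℓ.b9 → ℓ.b11 → ℓ.b10`, `Dag.lean`) at the
record — the node's statement UNEDITED (plan g60, chair R434 (Q2)).  WHICH `b10` the leaf carries is the record predicate's binding clause, not this text: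
at a world bound by `B10CompactBinding.ofPrintedAllXPNC X Y Z V W` the leaf is `DagDischarged.b10Compact X.toPrintedCarriers`
(`B10CompactBinding.ofPrintedAllXPNC_b10_iff`) and N08 HOLDS from leaf systems alone (`S_N08_of_upC` below); only at the LITERAL N-binding on fine-lattice
families is it vacuous-or-false (`B10NodeKnit.b10_main_iff_inEdge_fails_of_fineLattices`).  The route instantiates `Rec` with NODE 00's terminal predicate
of record, (C)-bound from its B10-pin stage on (R434); never with a stage that leaves the B10 carriers residual. -/
def S_N08 : Prop := AtRecord Rec Dag.B10_main

/-- **N08 IS SATISFIABLE BY BINDING (kernel; review p409153 (2))**: for EVERY record predicate whose worlds are bound, at every run, by the (C) COMPACT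
binding over carriers whose B10 runs are leaf-system tower runs ([B10] Thm 1 compact reading + Thm 2), `S_N08 Rec` HOLDS — in-edges unused
(`B10CompactBinding.b10_main_of_upC`; record form `B10NodeKnit.b10_main_at_record_of_leafSystemPin`).  Nothing of Bałaban's is asserted: the leaf systems
and the binding are hypotheses. -/
theorem S_N08_of_upC
    (hpin : ∀ (F : T4Family) (D : Datum F N) (w : DagBinding.WorldP), Rec F D w → ∀ P : B12.RunParams,
      ∃ (X : DagBinding.PrintedCarriersR) (Y : DagBinding.PrintedCarriers9X) (Z : DagBinding.PrintedCarriers11)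
        (V : DagBinding.PrintedCarriers14R) (W : DagBinding.PrintedCarriers15) (I : Type) (C : B10Assembly.Consts) (T : I → B10.TowerRun),
        Nonempty (∀ i, B10Assembly.LeafSystem C (T i)) ∧
          w.up P = B10CompactBinding.ofPrintedAllXPNC (X.withTowerRuns10 T) Y Z V W) :
    S_N08 Rec := by
  intro F D w hR P
  obtain ⟨X, Y, Z, V, W, I, C, T, ⟨S⟩, hup⟩ := hpin F D w hR P
  exact B10CompactBinding.b10_main_of_upC S hup
/-- N12 · [B15, Balaban1989LargeFieldI] `Dag.B15_main`. -/
def S_N12 : Prop := AtRecord Rec Dag.B15_main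
/-- N25 · binder B3 = END: endpoint existence of the coupling flow of the construction of record ([Balaban1987RG1] Thm 2 p. 259, endpoint half;
proof unprinted; YM-PLAN §2f sub-DAG (e1)∕(e2)∕(e3) below stub level). -/
def S_N25 : Prop := ∀ (F : T4Family) (D : Datum F N) (w : DagBinding.WorldP), Rec F D w → DagBinding.EndpointExistence D.C.toB12
/-- BetaSide · B2's β-side input: two-sided β-bounds with history in the interval on some `]0, γ₀] ⊇ ]0, γ]` ([Balaban1987RG1] (1.22) p. 264 upper
half, proof deferred in print; lower half printed nowhere — census T09.F). -/
def S_BetaSide : Prop := ∀ (F : T4Family) (D : Datum F N) (w : DagBinding.WorldP), Rec F D w →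
  ∃ γ₀ : ℝ, w.γ ≤ γ₀ ∧ DagBinding.BetaBoundsInInterval w.C.toB12 γ₀ w.b w.βup
/-- N26 · B4 LITERAL (β-continuity) — VACATED in the discharge form of record (named aside, venue `N26_B4.lean`; in no join of this module; its tree
consumer is `BalabanUVNodesN26BetaCont.lean`). -/
def N26_B4lit : Prop := ∀ (F : T4Family) (D : Datum F N) (w : DagBinding.WorldP), Rec F D w →
  ∃ γc : ℝ, 0 < γc ∧ FlowStep.BetaContH γc D.βfun

/-! ### K5 «SpineMatching» (rank 6): N27x · N20 · N21 · N19 · U4′   (K4 «SpineRates» = the hook `SpineRates` below) -/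

/-- N27x · THE TERM-CLASS EXPANSION OF RECORD EXISTS UNDER THE PINS, with `0 < l₀`, `0 < vol`, and its class sums ARE the string's dressed partition
functions after `K₀ + K` resp. `K₀ + K + 1` steps on `|t| ≤ l₀` (nodes E1∕E2) — for all small-coupling tuned runs of the datum of record and every loop
string (the extraction step; in-edges N11–N13, the R-operation's term format). -/
def S_N27x : Prop := ∀ (F : T4Family) (D : Datum F N) (w : DagBinding.WorldP), Rec F D w →
  B16.EndStatementBPrinted D.C → DagBinding.EndpointExistence D.C.toB12 →
    T4ContinuumYM4Torus.ForSmallCouplings D fun g₀ => ∀ os : List (ULoop F), ∃ S : SpineCarriers,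
      SRec F D g₀ os S ∧ 0 < S.l₀ ∧ 0 < S.vol ∧
        (∀ (K : ℕ) (t : ℝ), |t| ≤ S.l₀ →
          T4GenFunBounds.schemeZ (D.scheme g₀) os (S.K₀ + K) t = ∑ τ ∈ S.T K, S.A K t τ) ∧
        (∀ (K : ℕ) (t : ℝ), |t| ≤ S.l₀ →
          T4GenFunBounds.schemeZ (D.scheme g₀) os (S.K₀ + K + 1) t = ∑ τ ∈ S.T K, S.B K t τ)

/-- N20 · NE7b BY NAME at the carriers of record: `T4WeightBudget.RelWeightBound` (venue `N20_NE7b.lean`). -/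
def S_N20 : Prop := ∀ (F : T4Family) (D : Datum F N) (g₀ : ℕ → ℝ) (os : List (ULoop F)) (S : SpineCarriers),
  SRec F D g₀ os S → T4WeightBudget.RelWeightBound S.l₀ S.T S.A S.B S.Bad S.W

/-- N21 · NE7c BY NAME at the carriers of record: `T4IndicatorShell.ShellWeightBound` (venue `N21_NE7c.lean`). -/
def S_N21 : Prop := ∀ (F : T4Family) (D : Datum F N) (g₀ : ℕ → ℝ) (os : List (ULoop F)) (S : SpineCarriers),
  SRec F D g₀ os S → T4IndicatorShell.ShellWeightBound S.l₀ S.T S.A S.B S.shA S.shB S.Wsh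

/-- N19 · NE7 proper AS THE EDGE «in-edges ⇒ Core» (R420's second typing): at the carriers of record, GIVEN K4's conclusion for the string,
`Spine.NE7.Core` holds on the shell-free cores (venue `N19_NE7.lean` is the unguarded special case `Inputs := ⊤`). -/
def S_N19 : Prop := ∀ (F : T4Family) (D : Datum F N) (g₀ : ℕ → ℝ) (os : List (ULoop F)) (S : SpineCarriers),
  SRec F D g₀ os S → Inputs F D g₀ os → letI := S.dec;
    NE7.Core S.l₀ S.vol S.T S.Bad (fun K t τ => S.A K t τ - S.shA K t τ) (fun K t τ => S.B K t τ - S.shB K t τ) S.δ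

/-- U4′ · bookkeeping at the carriers of record: bad classes plus shells never exhaust the weight; the term-wise remainders are summable. -/
def S_U4 : Prop := ∀ (F : T4Family) (D : Datum F N) (g₀ : ℕ → ℝ) (os : List (ULoop F)) (S : SpineCarriers),
  SRec F D g₀ os S → (∀ K, S.W K + S.Wsh K < 1) ∧ Summable S.δ

/-! ## §4 The CLUSTER STATEMENTS (closed given the parameters) -/

/-- The K1 frame at `(D, w)`. -/
structure FrameIR {F : T4Family} (D : Datum F N) (w : DagBinding.WorldP) : Prop where
  construction : w.C = D.C
  gamma_pos : 0 < w.γ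
  rg : ∀ P : B12.RunParams, (DagBinding.leavesP w P).rgFlow
  datum₀ : Node00.IsDatumOfRecord₀ F N D
  b4 : ∀ P : B12.RunParams, Dag.B4_main (DagBinding.leavesP w P)
  b5 : ∀ P : B12.RunParams, Dag.B5_main (DagBinding.leavesP w P)

/-- **K1 «KnitIR»**: on every family the objects of record exist; at them the frame, the Stage-0 datum clause (⇒ B1), N01 and N02. -/
def KnitIR : Prop :=
  (∀ F : T4Family, ∃ (D : Datum F N) (w : DagBinding.WorldP), Rec F D w) ∧
    ∀ (F : T4Family) (D : Datum F N) (w : DagBinding.WorldP), Rec F D w → FrameIR D w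

/-- **K2 «FlowBounds»**: N03 ∧ N06 ∧ N10 ∧ N09 ∧ N11 ∧ N13 at every run of every world of record. -/
def FlowBounds : Prop :=
  AtRecord Rec fun ℓ => Dag.B6_main ℓ ∧ Dag.B9_main ℓ ∧ Dag.B13_main ℓ ∧ Dag.B12_main ℓ ∧ Dag.B14_main ℓ ∧ Dag.B16_main ℓ

/-- **K3 «RenormalisationBeta»**: N04 ∧ N05 ∧ N07 ∧ N08 ∧ N12 at every run, END at the datum, the β-side bounds at the world — for every record pair.
(The `Dag.B10_main` conjunct reads the record's own `b10` leaf: compact under the (C) binding of the predicate of record — see `S_N08`, `S_N08_of_upC`.) -/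
def RenormalisationBeta : Prop :=
  ∀ (F : T4Family) (D : Datum F N) (w : DagBinding.WorldP), Rec F D w →
    (∀ P : B12.RunParams, Dag.B7_main (DagBinding.leavesP w P) ∧ Dag.B8_main (DagBinding.leavesP w P) ∧
        Dag.B11_main (DagBinding.leavesP w P) ∧ Dag.B10_main (DagBinding.leavesP w P) ∧ Dag.B15_main (DagBinding.leavesP w P)) ∧
      DagBinding.EndpointExistence D.C.toB12 ∧
      ∃ γ₀ : ℝ, w.γ ≤ γ₀ ∧ DagBinding.BetaBoundsInInterval w.C.toB12 γ₀ w.b w.βup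

/-- **K4 «SpineRates» — CONCLUSION HOOK**: under the pins, for all small-coupling tuned runs of the datum of record and every loop string, the in-edges
of N19 hold (`Inputs`).  Its stubs N15∕N16∕N18∕N22 (+ glue N17, + N14 if moved) are the venue's by-name statements; their conjunction instantiates `Inputs`. -/
def SpineRates : Prop := ∀ (F : T4Family) (D : Datum F N) (w : DagBinding.WorldP), Rec F D w →
  B16.EndStatementBPrinted D.C → DagBinding.EndpointExistence D.C.toB12 →
    T4ContinuumYM4Torus.ForSmallCouplings D fun g₀ => ∀ os : List (ULoop F), Inputs F D g₀ os

/-- The per-string SPINE DATUM (= `YMDAG.SpineDatum` of `DagSpineEdge.lean` ee65035afec9e78f :48 VERBATIM — g73's road of record into B5; drop this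
copy when that file is the 32nd venue file ∕ in the tree): N20 ∧ N21 ∧ N19-on-cores ∧ U4′ ∧ E1∕E2 on explicit carriers. -/
def SpineDatum {F : T4Family} (D : Datum F N) (g₀ : ℕ → ℝ) (os : List (ULoop F)) : Prop :=
  ∃ (ι : Type) (_ : DecidableEq ι) (l₀ vol : ℝ) (K₀ : ℕ) (T : ℕ → Finset ι) (A B shA shB : ℕ → ℝ → ι → ℝ)
    (Bad : ℕ → ℝ → Finset ι) (W Wsh δ : ℕ → ℝ),
    0 < l₀ ∧ 0 < vol ∧
      T4WeightBudget.RelWeightBound l₀ T A B Bad W ∧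
      T4IndicatorShell.ShellWeightBound l₀ T A B shA shB Wsh ∧
      NE7.Core l₀ vol T Bad (fun K t τ => A K t τ - shA K t τ) (fun K t τ => B K t τ - shB K t τ) δ ∧
      (∀ K, W K + Wsh K < 1) ∧ Summable δ ∧
      (∀ K t, |t| ≤ l₀ → T4GenFunBounds.schemeZ (D.scheme g₀) os (K₀ + K) t = ∑ τ ∈ T K, A K t τ) ∧
      (∀ K t, |t| ≤ l₀ → T4GenFunBounds.schemeZ (D.scheme g₀) os (K₀ + K + 1) t = ∑ τ ∈ T K, B K t τ)

/-- **K5 «SpineMatching»** (R420 (C)'s conclusion, GUARDED by K4's conclusion so that `closes` consumes K4): under the pins, for all small-coupling tuned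
runs and every loop string, the in-edges of N19 IMPLY the spine datum.  With `Inputs := ⊤` this is R420's `ForSmallCouplings D (∀ os, SpineDatum D g₀ os)`. -/
def SpineMatching : Prop := ∀ (F : T4Family) (D : Datum F N) (w : DagBinding.WorldP), Rec F D w →
  B16.EndStatementBPrinted D.C → DagBinding.EndpointExistence D.C.toB12 →
    T4ContinuumYM4Torus.ForSmallCouplings D fun g₀ => ∀ os : List (ULoop F), Inputs F D g₀ os → SpineDatum D g₀ os

/-- **«Spine» = binder B5 = N27 AT THE RECORD** (`T4ApexHybrid.HybridNE7Under D END`, venue `N27_B5.lean`): the merged spine child (K4 + K5, tolerance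
(D)(ii)) and the glue target of `B5_at_record`. -/
def Spine : Prop := ∀ (F : T4Family) (D : Datum F N) (w : DagBinding.WorldP), Rec F D w →
  T4ApexHybrid.HybridNE7Under D (DagBinding.EndpointExistence D.C.toB12)

end Split

end YMDAG.UVSplit
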